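/-
Copyright (c) 2026 the pub-hodgecm-mathlib formalisation cell (harness21).  Prover seat hodgecm-mathlib-K2E1-p13 (g2), Track B ∕ K2-LIT, h413 = `stmt-HodgeConjecture-24833`,
line `K2_E1_TraceFormulaBeta`, ROADCARD «5Res ENDGAME BY FAMILIES» (dealer K2E1-plan (g7) (154)) pre-deal C3, FILE 0: THE ABSTRACT BERNSTEIN–LAPID §5 ENGINE behind
★ `K2E1ScatteringFunctionalEquationCMTwo` (p859865), typed once for every currency (spherical, `(χ,τ)` at the `K_U`-slice, `N = 3`, matrix editions).
-/
import Summits.HodgeConjecture.HodgeConjecture.Theorems.K2E1ConvexDiffCountableConnected   -- ★ p859595: `isPreconnected_convex_diff_of_countable`, `countable_of_codiscrete`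
import Mathlib.Analysis.Complex.CauchyIntegral
import Mathlib.Analysis.Analytic.Uniqueness
import HarnessLib

/-!
# `K2E1ScatteringFunctionalEquationOfUnique` — THE FUNCTIONAL EQUATION OF THE SCATTERING COEFFICIENT FROM UNIQUENESS: THE ABSTRACT ENGINE

Track B ∕ K2-LIT, crux h413 = `stmt-HodgeConjecture-24833`, route of record `HCCMUnconditional`; cell `hodgecm-mathlib`, squad K2, ENGINE E1.  THEOREMS ONLY (no `def`, no `instance`,
no `notation`, no `sorry`; default heartbeats); lane `--supports stmt-HodgeConjecture-24833 --as helper` (count-neutral).  Mathlib-level statements (modules over `ℂ`, sets in `ℂ`);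
the only project import is ★ `K2E1ConvexDiffCountableConnected` (an open convex set minus a countable set is preconnected).

WHAT.  ★ `K2E1ScatteringFunctionalEquationCMTwo` proves `c̃(z)·c̃(1 − z) = 1` for the spherical Eisenstein series of `U(1,1)_{L∕L⁺}` in three non-structural steps; this file states
each step ABSTRACTLY, so that the `(χ,τ)`-families (ROADCARD C3: constant-term parameter `b ∈ B′` finite-dimensional, `cnst_N(ι ψ) = φ₀•α₁(z) + L(z) b`, non-degeneracy
«`L(z)` injective», ★ X1_χ `exists_chi_xSystem_byproducts`), the rank `N = 3` prints (`z ↦ 2 − z`) and the matrix editions consume the SAME lemmas: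
* §1 **`smul_eq_of_xSystem_unique`** [BernsteinLapid2019, §5]: the Bernstein–Lapid system at `z` — Hecke equations `T_i ψ = e_i•ψ`, constant-term equation `Cn ψ = φ₀•a₁ + L b`
  (`L : B′ → 𝓦` linear INJECTIVE), side condition `Q ψ = 0` — has the solution `(v, cb)` and UNIQUENESS (the exported clause of ★ X1∕★ F1∕★ X1_χ, verbatim shape); a second vector
  `v′` (the Eisenstein vector of the DUAL datum at `ρ₀ − z`, after the symmetry `ĥ_i(ρ₀ − z) = ĥ_i(z)` ★ `sphericalTransform_symm_cm_two∕three` and the swap of the constant-term vectors)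
  satisfies `T_i v′ = e_i•v′`, `Cn v′ = L u′ + s•a₁`, `Q v′ = 0`.  THEN **`s • cb = φ₀ • u′`** — for `B′ = ℂ`, `L b = b•α₂(z)`, `u′ = 1`, `s = cc(1−z)` this is `cc(1−z)·cc(z) = φ₀`.
  Proof: `s ≠ 0` ⇒ `(φ₀∕s)•v′` solves the system with `b = (φ₀∕s)•u′` ⇒ uniqueness; `s = 0` ⇒ `v + v′` solves it with `b = cb + u′` ⇒ `v′ = 0` ⇒ `L u′ = 0` ⇒ `u′ = 0`.  No case
  hypothesis on the data; `smul_eq_of_xSystem_unique_one` is the datum-`1` form.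
* §2 **`eqOn_diff_of_eqOn_re_gt`** (identification on a co-discrete holomorphy set; values in a complete normed `ℂ`-space, so `B′`-valued parameters are covered): `U ⊆ ball 0 r` open and
  co-discrete in the ball, `f` holomorphic on `U`, `P` closed countable with `P ⊆ {Re ≤ σ₀}`, `g` analytic on `U ∖ P`, `f = g` on `U ∩ {σ₀ < Re}` (the ball meets `{σ₀ < Re}`) ⟹ `f = g` on
  `U ∖ P` — identity theorem on `U ∖ P = ball ∖ ((ball ∖ U) ∪ P)` (convex minus countable ⇒ preconnected; `ball ∖ U` is discrete hence countable, `ℂ` hereditarily Lindelöf).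
* §3 **`exists_mem_and_sub_mem`** (a base point): co-discreteness of `U`, `P` at `z⋆` and of `U′`, `P′` at `ρ − z⋆` give `z₀` with `z₀ ∈ U ∖ P`, `ρ − z₀ ∈ U′ ∖ P′` (the involution
  `s ↦ ρ − s` maps `𝓝[≠] z⋆` to `𝓝[≠] (ρ − z⋆)`); **`mul_eq_one_of_eventually`** (globalisation): `c` analytic off a countable `P`, `c′` analytic off a countable `P′`,
  `c(z)·c′(ρ − z) = 1` near one point ⟹ for ALL `z ∉ P`, `ρ − z ∉ P′` (identity theorem on `ℂ ∖ (P ∪ (ρ − P′))`, preconnected: countable complement).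
* §4 (ED. 2) **`eq_zero_of_xSystem_unique`** (homogeneous uniqueness from uniqueness at one datum), **`sum_smul_eq_of_xSystem_unique`**∕**`…_of_datum`** (THE MATRIX ENGINE:
  `z`-side solutions `(v_j, cb_j)_{j∈κ}` at data `a_j`, dual vector with `Cn v′ = L u′ + Σ_j s_j•a_j` ⟹ `Σ_j s_j • cb_j = u′`, i.e. `M′(1−z)·M(z) = 1` in column currency; NO injectivity,
  no case split) and **`smul_eq_of_xSystem_unique'`** (§1 without the superfluous `Injective L`).
CONSUMPTION RECIPE (checked on ★ F2's §2 in a scratch file, rc 0): for a per-ball package of ★ X1∕F1 (CLMs `T i`, `cnstN`, `iota hb`; `α₁ α₂`, `vX`, `cc`, uniqueness at datum `1`)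
take `Cn := (cnstN …).comp (iota hb)` (rewrite `ContinuousLinearMap.comp_apply`), `Q := 0`, `L := (ContinuousLinearMap.id ℂ ℂ).smulRight (α₂ z)` (injective by
`smul_left_injective ℂ (hα₂ne z hz)`), `e i := ĥ_i(z)`, `v := vX z`, `cb := cc z`, `v′ := vX (1 − z)`, `u′ := 1`, `s := cc (1 − z)` (eigen-equations of `v′` by ★
`sphericalTransform_symm_cm_two`, constant term by the swap `α₁(1−z) = α₂ z`, `α₂(1−z) = α₁ z` via `Lp.ext`); `smul_eq_of_xSystem_unique_one` returns `cc (1 − z) • cc z = 1`.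
For ★ X1_χ (`exists_chi_xSystem_byproducts`): `L := L z`, `hL := hLinj z …`, `Q := Q`, the uniqueness clause verbatim.
HONEST LABEL: HC_CM is proved only modulo the 7 printed citations (2 remaining named inputs: hLiu418 = `stmt-HodgeConjecture-24832`, h413 = `stmt-HodgeConjecture-24833`) until rung 0
closes; this file asserts no named fact, closes no socket; count-neutral; letter-free.
[cite: BernsteinLapid2019, §5 and §4 Claim 3 (p. 9)] [cite: MoeglinWaldspurger1995, IV.1.10] [cite: Langlands1976, §7]

## References
* [BernsteinLapid2019] J. Bernstein, E. Lapid, *On the meromorphic continuation of Eisenstein series*, J. AMS 37 (2024), §4 Claim 3, §5 (functional equations from uniqueness).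
* [MoeglinWaldspurger1995] C. Mœglin, J.-L. Waldspurger, *Spectral decomposition and Eisenstein series* (1995), IV.1.10 (functional equation of the intertwining operators).
* [Langlands1976] R. P. Langlands, *On the Functional Equations Satisfied by Eisenstein Series*, LNM 544 (1976), §7.
-/

set_option autoImplicit false
set_option linter.dupNamespace false  -- the mandated namespace repeats the summit's segment (`HodgeConjecture.HodgeConjecture`)

noncomputable section

open Filter Topology Set
open Summit.HodgeConjecture.HodgeConjecture.Cruxes.H413.K2E1ConvexDiffCountableConnected (isPreconnected_convex_diff_of_countable)

namespace Summit.HodgeConjecture.HodgeConjecture.Cruxes.H413.K2E1ScatteringFunctionalEquationOfUnique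

/-! ## §1 The functional equation from UNIQUENESS of the Bernstein–Lapid system (pure linear algebra) -/

section Unique

variable {𝓗 𝓦 B X : Type*} [AddCommGroup 𝓗] [Module ℂ 𝓗] [AddCommGroup 𝓦] [Module ℂ 𝓦] [AddCommGroup B] [Module ℂ B] [AddCommGroup X] [Module ℂ X]
  {ι FT FC FQ FL : Type*} [FunLike FT 𝓗 𝓗] [LinearMapClass FT ℂ 𝓗 𝓗] [FunLike FC 𝓗 𝓦] [LinearMapClass FC ℂ 𝓗 𝓦]
  [FunLike FQ 𝓗 X] [LinearMapClass FQ ℂ 𝓗 X] [FunLike FL B 𝓦] [LinearMapClass FL ℂ B 𝓦]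

/-- **THE FUNCTIONAL EQUATION FROM UNIQUENESS** [BernsteinLapid2019, §5].  The system at `z`: Hecke equations `T_i ψ = e_i•ψ`, constant-term equation `Cn ψ = φ₀•a₁ + L b` with
`L : B′ → 𝓦` linear injective, side condition `Q ψ = 0`; it has the solution `(v, cb)` and UNIQUENESS (★ X1∕F1∕X1_χ's clause shape).  A second vector `v′` with `T_i v′ = e_i•v′`,
`Cn v′ = L u′ + s•a₁`, `Q v′ = 0` (the dual Eisenstein vector at `ρ₀ − z` after the symmetry of the `ĥ_i` and the swap of the constant-term vectors) forces **`s • cb = φ₀ • u′`**: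
if `s ≠ 0`, `(φ₀∕s)•v′` solves the system with `b = (φ₀∕s)•u′`; if `s = 0`, `v + v′` solves it with `b = cb + u′`, so `v′ = 0`, `L u′ = 0`, `u′ = 0`.
[cite: BernsteinLapid2019, §5 and §4 Claim 3 (p. 9)] [cite: MoeglinWaldspurger1995, IV.1.10] -/
theorem smul_eq_of_xSystem_unique (T : ι → FT) (e : ι → ℂ) (Cn : FC) (Q : FQ) (φ₀ : ℂ) (a₁ : 𝓦) {L : FL} (hL : Function.Injective L)
    {v : 𝓗} {cb : B} (hvT : ∀ i, T i v = e i • v) (hvC : Cn v = φ₀ • a₁ + L cb) (hvQ : Q v = 0)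
    (huniq : ∀ (ψ : 𝓗) (b : B), (∀ i, T i ψ = e i • ψ) → Cn ψ = φ₀ • a₁ + L b → Q ψ = 0 → ψ = v ∧ b = cb)
    {v' : 𝓗} {s : ℂ} {u' : B} (hv'T : ∀ i, T i v' = e i • v') (hv'C : Cn v' = L u' + s • a₁) (hv'Q : Q v' = 0) :
    s • cb = φ₀ • u' := by
  by_cases hs : s = 0
  · -- `v + v′` solves the system with parameter `cb + u′`: uniqueness ⇒ `v′ = 0` ⇒ `L u′ = 0` ⇒ `u′ = 0`
    have hT : ∀ i, T i (v + v') = e i • (v + v') := fun i => by rw [map_add, hvT i, hv'T i, smul_add]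
    have hC : Cn (v + v') = φ₀ • a₁ + L (cb + u') := by
      rw [map_add, hvC, hv'C, hs, zero_smul, add_zero, map_add, add_assoc (φ₀ • a₁)]
    have hQ : Q (v + v') = 0 := by rw [map_add, hvQ, hv'Q, add_zero]
    have h0 : v' = 0 := by simpa using (huniq _ _ hT hC hQ).1
    have hu : L u' = L 0 := by
      have h := hv'C
      rw [h0, map_zero, hs, zero_smul, add_zero] at h
      rw [← h, map_zero]
    rw [hs, zero_smul, hL hu, smul_zero]
  · -- `(φ₀∕s) • v′` solves the system with parameter `(φ₀∕s) • u′`: uniqueness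
    have hT : ∀ i, T i ((φ₀ * s⁻¹) • v') = e i • ((φ₀ * s⁻¹) • v') := fun i => by rw [map_smul, hv'T i, smul_smul, smul_smul, mul_comm (φ₀ * s⁻¹)]
    have hC : Cn ((φ₀ * s⁻¹) • v') = φ₀ • a₁ + L ((φ₀ * s⁻¹) • u') := by
      rw [map_smul, hv'C, smul_add, smul_smul, mul_assoc, inv_mul_cancel₀ hs, mul_one, map_smul, add_comm]
    have hQ : Q ((φ₀ * s⁻¹) • v') = 0 := by rw [map_smul, hv'Q, smul_zero]
    have h := (huniq _ _ hT hC hQ).2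
    rw [← h, smul_smul, mul_comm s, mul_assoc, inv_mul_cancel₀ hs, mul_one]

/-- **Datum `1`**: with `φ₀ = 1` the conclusion reads `s • cb = u′` (for `B′ = ℂ`, `L b = b•α₂(z)`, `u′ = 1`: `cc(1 − z)·cc(z) = 1`, ★ `K2E1ScatteringFunctionalEquationCMTwo` §2).
[cite: BernsteinLapid2019, §5] -/
theorem smul_eq_of_xSystem_unique_one (T : ι → FT) (e : ι → ℂ) (Cn : FC) (Q : FQ) (a₁ : 𝓦) {L : FL} (hL : Function.Injective L)
    {v : 𝓗} {cb : B} (hvT : ∀ i, T i v = e i • v) (hvC : Cn v = (1 : ℂ) • a₁ + L cb) (hvQ : Q v = 0)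
    (huniq : ∀ (ψ : 𝓗) (b : B), (∀ i, T i ψ = e i • ψ) → Cn ψ = (1 : ℂ) • a₁ + L b → Q ψ = 0 → ψ = v ∧ b = cb)
    {v' : 𝓗} {s : ℂ} {u' : B} (hv'T : ∀ i, T i v' = e i • v') (hv'C : Cn v' = L u' + s • a₁) (hv'Q : Q v' = 0) :
    s • cb = u' := by
  rw [smul_eq_of_xSystem_unique T e Cn Q 1 a₁ hL hvT hvC hvQ huniq hv'T hv'C hv'Q, one_smul]

end Unique

/-! ## §2 Identification on a co-discrete holomorphy set (generic complex analysis) -/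

/-- **IDENTIFICATION ON A CO-DISCRETE HOLOMORPHY SET.**  `U ⊆ ball 0 r` open and co-discrete in the ball (★ X1's holomorphy set), `f` holomorphic on `U` with values in a complete normed
`ℂ`-space, `P` closed and countable with `P ⊆ {Re ≤ σ₀}`, `g` analytic at every point of `U ∖ P`, and `f = g` on `U ∩ {σ₀ < Re}` where the ball meets `{σ₀ < Re}`.  THEN `f = g` on
`U ∖ P`: the identity theorem on `U ∖ P = ball ∖ ((ball ∖ U) ∪ P)` — an open convex set minus a countable set is preconnected (★ `isPreconnected_convex_diff_of_countable`; `ball ∖ U` is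
discrete hence countable, `ℂ` being hereditarily Lindelöf), and a point of `U ∩ {σ₀ < Re}` exists by co-discreteness. [cite: BernsteinLapid2019, Thm 2.3 and §4 Claim 5 (p. 10)] -/
theorem eqOn_diff_of_eqOn_re_gt {𝓔 : Type*} [NormedAddCommGroup 𝓔] [NormedSpace ℂ 𝓔] [CompleteSpace 𝓔] {U P : Set ℂ} {r σ₀ : ℝ} {f g : ℂ → 𝓔}
    (hUo : IsOpen U) (hUD : U ⊆ Metric.ball (0 : ℂ) r) (hUcd : ∀ z₀ ∈ Metric.ball (0 : ℂ) r, ∀ᶠ s in 𝓝[≠] z₀, s ∈ U) (hf : DifferentiableOn ℂ f U)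
    (hPc : IsClosed P) (hPcount : P.Countable) (hPre : ∀ z ∈ P, z.re ≤ σ₀) (hg : ∀ z ∈ U, z ∉ P → AnalyticAt ℂ g z)
    {z₁ : ℂ} (hz₁ : z₁ ∈ Metric.ball (0 : ℂ) r) (hz₁re : σ₀ < z₁.re) (heq : ∀ z ∈ U, σ₀ < z.re → f z = g z) :
    ∀ z ∈ U, z ∉ P → f z = g z := by
  have hA : AnalyticOnNhd ℂ f (U \ P) := (hf.mono fun _ hz => hz.1).analyticOnNhd (hUo.sdiff hPc)
  have hB : AnalyticOnNhd ℂ g (U \ P) := fun z hz => hg z hz.1 hz.2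
  -- `U ∖ P = ball ∖ ((ball ∖ U) ∪ P)` is preconnected
  have hcount : (Metric.ball (0 : ℂ) r \ U).Countable := by
    have hdisc : IsDiscrete (Metric.ball (0 : ℂ) r \ U) := by
      rw [isDiscrete_iff_nhdsNE]
      intro x hx
      rw [Filter.inf_principal_eq_bot]
      exact (hUcd x hx.1).mono fun _ hs hs' => hs'.2 hs
    exact (HereditarilyLindelofSpace.isLindelof _).countable_of_isDiscrete hdisc
  have hset : U \ P = Metric.ball (0 : ℂ) r \ ((Metric.ball (0 : ℂ) r \ U) ∪ P) := by
    ext z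
    constructor
    · rintro ⟨hzU, hzP⟩
      exact ⟨hUD hzU, by rintro (⟨-, hzU'⟩ | hzP'); exacts [hzU' hzU, hzP hzP']⟩
    · rintro ⟨hzb, hz⟩
      exact ⟨by_contra fun hzU => hz (Or.inl ⟨hzb, hzU⟩), fun hzP => hz (Or.inr hzP)⟩
  have hpre : IsPreconnected (U \ P) := by
    rw [hset]
    exact isPreconnected_convex_diff_of_countable Literature.Topology.Euclidean.one_lt_rank_real_complex (convex_ball (0 : ℂ) r) Metric.isOpen_ball (hcount.union hPcount)
  -- a base point `z₂ ∈ U ∩ {σ₀ < Re}` (co-discreteness of `U` at `z₁`), off `P`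
  obtain ⟨z₂, hz₂U, hz₂re⟩ : ∃ z₂ : ℂ, z₂ ∈ U ∧ σ₀ < z₂.re :=
    ((hUcd z₁ hz₁).and (mem_nhdsWithin_of_mem_nhds ((isOpen_lt continuous_const Complex.continuous_re).mem_nhds hz₁re))).exists
  have hz₂P : z₂ ∉ P := fun h => by linarith [hPre z₂ h]
  have hev : f =ᶠ[𝓝 z₂] g := by
    filter_upwards [hUo.mem_nhds hz₂U, (isOpen_lt continuous_const Complex.continuous_re).mem_nhds hz₂re] with z hzU hzre
    exact heq z hzU hzre
  have hEq := hA.eqOn_of_preconnected_of_eventuallyEq hB hpre ⟨hz₂U, hz₂P⟩ hev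
  exact fun z hzU hzP => hEq ⟨hzU, hzP⟩

/-! ## §3 A base point, and the globalisation off the pole sets -/

/-- **A BASE POINT FOR THE FUNCTIONAL EQUATION**: if `U` and `Pᶜ` are punctured neighbourhood-generic at `z⋆` and `U′`, `P′ᶜ` at `ρ − z⋆` (co-discreteness, ★ X1∕X2's clauses), there is
`z₀` with `z₀ ∈ U`, `z₀ ∉ P`, `ρ − z₀ ∈ U′`, `ρ − z₀ ∉ P′` — the involution `s ↦ ρ − s` maps `𝓝[≠] z⋆` into `𝓝[≠] (ρ − z⋆)`. [cite: BernsteinLapid2019, §5] -/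
theorem exists_mem_and_sub_mem {U U' P P' : Set ℂ} (ρ zs : ℂ)
    (hU : ∀ᶠ s in 𝓝[≠] zs, s ∈ U) (hP : ∀ᶠ s in 𝓝[≠] zs, s ∉ P) (hU' : ∀ᶠ s in 𝓝[≠] (ρ - zs), s ∈ U') (hP' : ∀ᶠ s in 𝓝[≠] (ρ - zs), s ∉ P') :
    ∃ z₀ : ℂ, (z₀ ∈ U ∧ z₀ ∉ P) ∧ (ρ - z₀ ∈ U' ∧ ρ - z₀ ∉ P') := by
  have htend : Tendsto (fun s : ℂ => ρ - s) (𝓝[≠] zs) (𝓝[≠] (ρ - zs)) := by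
    refine tendsto_nhdsWithin_of_tendsto_nhds_of_eventually_within _ (((continuous_const.sub continuous_id).tendsto zs).mono_left nhdsWithin_le_nhds)
      (eventually_nhdsWithin_of_forall fun s hs h1s => hs ?_)
    rw [mem_singleton_iff] at h1s ⊢
    exact sub_right_injective h1s
  exact ((hU.and hP).and (htend.eventually (hU'.and hP'))).exists

/-- **GLOBALISATION OF THE FUNCTIONAL EQUATION OFF THE POLE SETS.**  `c` analytic off a countable `P`, `c′` analytic off a countable `P′` (the pole sets of ★ X2's `exists_global_pole_set`
are closed and co-discrete, hence countable: ★ `countable_of_codiscrete`), and `c(z)·c′(ρ − z) = 1` on a neighbourhood of one point.  THEN `c(z)·c′(ρ − z) = 1` for ALL `z ∉ P` with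
`ρ − z ∉ P′`: `z ↦ c(z)c′(ρ − z)` is analytic on `ℂ ∖ (P ∪ (ρ − P′))`, which is preconnected (countable complement, ★ `isPreconnected_convex_diff_of_countable`), and the identity
theorem applies (Mathlib `AnalyticOnNhd.eqOn_of_preconnected_of_eventuallyEq`). [cite: MoeglinWaldspurger1995, IV.1.10] [cite: Langlands1976, §7] [cite: BernsteinLapid2019, §5] -/
theorem mul_eq_one_of_eventually {P P' : Set ℂ} {c c' : ℂ → ℂ} (ρ : ℂ) (hPcount : P.Countable) (hP'count : P'.Countable)
    (hc : ∀ z : ℂ, z ∉ P → AnalyticAt ℂ c z) (hc' : ∀ z : ℂ, z ∉ P' → AnalyticAt ℂ c' z)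
    {z₀ : ℂ} (hloc : ∀ᶠ z in 𝓝 z₀, c z * c' (ρ - z) = 1) :
    ∀ z : ℂ, z ∉ P → ρ - z ∉ P' → c z * c' (ρ - z) = 1 := by
  -- the local identity holds near a point `z₁` OFF both pole sets (co-countability is not needed: shrink to the open set where it holds and use its non-emptiness off `P ∪ (ρ − P′)`)
  have hcount : (P ∪ (fun z : ℂ => ρ - z) ⁻¹' P').Countable := hPcount.union (hP'count.preimage sub_right_injective)
  have hpre : IsPreconnected (univ \ (P ∪ (fun z : ℂ => ρ - z) ⁻¹' P')) :=
    isPreconnected_convex_diff_of_countable Literature.Topology.Euclidean.one_lt_rank_real_complex convex_univ isOpen_univ hcount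
  have hfan : AnalyticOnNhd ℂ (fun z => c z * c' (ρ - z)) (univ \ (P ∪ (fun z : ℂ => ρ - z) ⁻¹' P')) := fun z hz =>
    (hc z fun h => hz.2 (Or.inl h)).mul ((hc' (ρ - z) fun h => hz.2 (Or.inr h)).comp (analyticAt_const.sub analyticAt_id))
  -- a point `z₁` near `z₀`, off the countable exceptional set, where the identity still holds on a neighbourhood
  obtain ⟨V, hVloc, hVo, hz₀V⟩ := eventually_nhds_iff.1 hloc
  have hdense : Dense (P ∪ (fun z : ℂ => ρ - z) ⁻¹' P')ᶜ := hcount.dense_compl ℂ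
  obtain ⟨z₁, hz₁V, hz₁⟩ := hdense.inter_open_nonempty V hVo ⟨z₀, hz₀V⟩
  have hev : (fun z => c z * c' (ρ - z)) =ᶠ[𝓝 z₁] fun _ => (1 : ℂ) := by
    filter_upwards [hVo.mem_nhds hz₁V] with z hz
    exact hVloc z hz
  have hEq := hfan.eqOn_of_preconnected_of_eventuallyEq analyticOnNhd_const hpre ⟨mem_univ z₁, hz₁⟩ hev
  exact fun z hzP hzP' => hEq ⟨mem_univ z, by rintro (h | h); exacts [hzP h, hzP' h]⟩

/-! ## §4 (ED. 2) Homogeneous uniqueness and the MATRIX engine — no injectivity hypothesis (ROADCARD C3 column currency, D4′c)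

For a `(χ,τ)`-family the constant-term parameter is a vector `b ∈ B = ι′ → ℂ` (★ X1_χ §2a `exists_chi_constantTerm_data_cm_two`: `L(z) b = Σ_j b_j•[f^{φ′_j}_{1−z}]`), and the dual
Eisenstein vector `v′ = [E(f^{φ′_{j₀}}_{1−z})]` has constant term `[f^{φ′_{j₀}}_{1−z}] + Σ_i cc′(1−z)_i•[f^{φ_i}_z] = L(z) e_{j₀} + Σ_i s_i • a₁ i` along a BASIS `(φ_i)_{i ∈ κ}` of
`V(χ)`.  With the `z`-side solutions `(v_i, cb_i)` for every datum `φ_i`, the vector `v′ − Σ_i s_i•v_i` solves the HOMOGENEOUS system with parameter `e_{j₀} − Σ_i s_i•cb_i`, so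
uniqueness gives the matrix functional equation `Σ_i cc′(1−z)_i • cc_i(z) = e_{j₀}` (`M′(1−z)·M(z) = 1`).  The degenerate-case injectivity of §1 is not needed: the uniqueness
clause's parameter component already forces the homogeneous parameter to vanish. -/

section Matrix

variable {𝓗 𝓦 B X : Type*} [AddCommGroup 𝓗] [Module ℂ 𝓗] [AddCommGroup 𝓦] [Module ℂ 𝓦] [AddCommGroup B] [Module ℂ B] [AddCommGroup X] [Module ℂ X]
  {ι FT FC FQ FL : Type*} [FunLike FT 𝓗 𝓗] [LinearMapClass FT ℂ 𝓗 𝓗] [FunLike FC 𝓗 𝓦] [LinearMapClass FC ℂ 𝓗 𝓦]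
  [FunLike FQ 𝓗 X] [LinearMapClass FQ ℂ 𝓗 X] [FunLike FL B 𝓦] [LinearMapClass FL ℂ B 𝓦]

/-- **HOMOGENEOUS UNIQUENESS** from uniqueness at one datum `a` with a solution `(v, cb)`: a solution `(ψ, b)` of `T_i ψ = e_i•ψ`, `Cn ψ = L b`, `Q ψ = 0` vanishes, `ψ = 0` and
`b = 0` (`(v + ψ, cb + b)` solves the `a`-system). [cite: BernsteinLapid2019, §4 Claim 3 (p. 9)] -/
theorem eq_zero_of_xSystem_unique (T : ι → FT) (e : ι → ℂ) (Cn : FC) (Q : FQ) (a : 𝓦) (L : FL)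
    {v : 𝓗} {cb : B} (hvT : ∀ i, T i v = e i • v) (hvC : Cn v = a + L cb) (hvQ : Q v = 0)
    (huniq : ∀ (ψ : 𝓗) (b : B), (∀ i, T i ψ = e i • ψ) → Cn ψ = a + L b → Q ψ = 0 → ψ = v ∧ b = cb)
    {ψ : 𝓗} {b : B} (hψT : ∀ i, T i ψ = e i • ψ) (hψC : Cn ψ = L b) (hψQ : Q ψ = 0) : ψ = 0 ∧ b = 0 := by
  have hT : ∀ i, T i (v + ψ) = e i • (v + ψ) := fun i => by rw [map_add, hvT i, hψT i, smul_add]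
  have hC : Cn (v + ψ) = a + L (cb + b) := by rw [map_add, hvC, hψC, map_add, add_assoc]
  have hQ : Q (v + ψ) = 0 := by rw [map_add, hvQ, hψQ, add_zero]
  obtain ⟨h1, h2⟩ := huniq _ _ hT hC hQ
  exact ⟨by simpa using h1, by simpa using h2⟩

/-- **THE MATRIX ENGINE** [BernsteinLapid2019, §5].  `z`-side: a family of solutions `(v_j, cb_j)_{j ∈ κ}` (`T_i v_j = e_i•v_j`, `Cn v_j = a_j + L cb_j`, `Q v_j = 0`) and HOMOGENEOUS
uniqueness of the parameter (`eq_zero_of_xSystem_unique`); dual side: `v′` with `T_i v′ = e_i•v′`, `Cn v′ = L u′ + Σ_j s_j•a_j`, `Q v′ = 0`.  THEN **`Σ_j s_j • cb_j = u′`** (the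
vector `v′ − Σ_j s_j•v_j` solves the homogeneous system with parameter `u′ − Σ_j s_j•cb_j`).  No injectivity of `L`, no case split. [cite: BernsteinLapid2019, §5]
[cite: MoeglinWaldspurger1995, IV.1.10] -/
theorem sum_smul_eq_of_xSystem_unique {κ : Type*} [Fintype κ] (T : ι → FT) (e : ι → ℂ) (Cn : FC) (Q : FQ) (a : κ → 𝓦) (L : FL)
    {v : κ → 𝓗} {cb : κ → B} (hvT : ∀ j i, T i (v j) = e i • v j) (hvC : ∀ j, Cn (v j) = a j + L (cb j)) (hvQ : ∀ j, Q (v j) = 0)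
    (huniq0 : ∀ (ψ : 𝓗) (b : B), (∀ i, T i ψ = e i • ψ) → Cn ψ = L b → Q ψ = 0 → b = 0)
    {v' : 𝓗} {s : κ → ℂ} {u' : B} (hv'T : ∀ i, T i v' = e i • v') (hv'C : Cn v' = L u' + ∑ j, s j • a j) (hv'Q : Q v' = 0) :
    ∑ j, s j • cb j = u' := by
  have hT : ∀ i, T i (v' - ∑ j, s j • v j) = e i • (v' - ∑ j, s j • v j) := fun i => by
    rw [map_sub, map_sum, hv'T i, smul_sub, Finset.smul_sum]
    congr 1
    exact Finset.sum_congr rfl fun j _ => by rw [map_smul, hvT j i, smul_comm (s j) (e i) (v j)]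
  have hsum : ∑ j, Cn (s j • v j) = ∑ j, s j • a j + ∑ j, L (s j • cb j) := by
    rw [← Finset.sum_add_distrib]
    exact Finset.sum_congr rfl fun j _ => by simp only [map_smul, hvC j, smul_add]
  have hC : Cn (v' - ∑ j, s j • v j) = L (u' - ∑ j, s j • cb j) := by
    rw [map_sub, map_sum, hv'C, hsum, map_sub, map_sum]
    abel
  have hQ : Q (v' - ∑ j, s j • v j) = 0 := by
    rw [map_sub, map_sum, hv'Q, zero_sub, neg_eq_zero]
    exact Finset.sum_eq_zero fun j _ => by rw [map_smul, hvQ j, smul_zero]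
  exact (sub_eq_zero.1 (huniq0 _ _ hT hC hQ)).symm

/-- **THE MATRIX ENGINE, uniqueness supplied at one datum `j₀`** (★ X1∕X1_χ's exported clause shape): homogeneous uniqueness is `eq_zero_of_xSystem_unique` at `j₀`.
[cite: BernsteinLapid2019, §5] -/
theorem sum_smul_eq_of_xSystem_unique_of_datum {κ : Type*} [Fintype κ] (T : ι → FT) (e : ι → ℂ) (Cn : FC) (Q : FQ) (a : κ → 𝓦) (L : FL)
    {v : κ → 𝓗} {cb : κ → B} (hvT : ∀ j i, T i (v j) = e i • v j) (hvC : ∀ j, Cn (v j) = a j + L (cb j)) (hvQ : ∀ j, Q (v j) = 0)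
    (j₀ : κ) (huniq : ∀ (ψ : 𝓗) (b : B), (∀ i, T i ψ = e i • ψ) → Cn ψ = a j₀ + L b → Q ψ = 0 → ψ = v j₀ ∧ b = cb j₀)
    {v' : 𝓗} {s : κ → ℂ} {u' : B} (hv'T : ∀ i, T i v' = e i • v') (hv'C : Cn v' = L u' + ∑ j, s j • a j) (hv'Q : Q v' = 0) :
    ∑ j, s j • cb j = u' :=
  sum_smul_eq_of_xSystem_unique T e Cn Q a L hvT hvC hvQ
    (fun _ _ hT hC hQ => (eq_zero_of_xSystem_unique T e Cn Q (a j₀) L (hvT j₀) (hvC j₀) (hvQ j₀) huniq hT hC hQ).2) hv'T hv'C hv'Q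

/-- **THE SCALAR ENGINE WITHOUT INJECTIVITY** (supersedes §1's `hL` hypothesis): `z`-side solution `(v, cb)` at datum `φ₀•a₁` with uniqueness, dual vector `v′` with
`Cn v′ = L u′ + s•a₁` ⟹ `s • cb = φ₀ • u′` (`φ₀•v′ − s•v` solves the homogeneous system with parameter `φ₀•u′ − s•cb`). [cite: BernsteinLapid2019, §5] -/
theorem smul_eq_of_xSystem_unique' (T : ι → FT) (e : ι → ℂ) (Cn : FC) (Q : FQ) (φ₀ : ℂ) (a₁ : 𝓦) (L : FL)
    {v : 𝓗} {cb : B} (hvT : ∀ i, T i v = e i • v) (hvC : Cn v = φ₀ • a₁ + L cb) (hvQ : Q v = 0)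
    (huniq : ∀ (ψ : 𝓗) (b : B), (∀ i, T i ψ = e i • ψ) → Cn ψ = φ₀ • a₁ + L b → Q ψ = 0 → ψ = v ∧ b = cb)
    {v' : 𝓗} {s : ℂ} {u' : B} (hv'T : ∀ i, T i v' = e i • v') (hv'C : Cn v' = L u' + s • a₁) (hv'Q : Q v' = 0) :
    s • cb = φ₀ • u' := by
  have hT : ∀ i, T i (φ₀ • v' - s • v) = e i • (φ₀ • v' - s • v) := fun i => by
    rw [map_sub, map_smul, map_smul, hv'T i, hvT i, smul_sub, smul_comm φ₀ (e i) v', smul_comm s (e i) v]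
  have hC : Cn (φ₀ • v' - s • v) = L (φ₀ • u' - s • cb) := by
    simp only [map_sub, map_smul, hv'C, hvC, smul_add, smul_smul]
    rw [mul_comm s φ₀]
    abel
  have hQ : Q (φ₀ • v' - s • v) = 0 := by
    rw [map_sub, map_smul, map_smul, hv'Q, hvQ, smul_zero, smul_zero, sub_zero]
  have h := (eq_zero_of_xSystem_unique T e Cn Q (φ₀ • a₁) L hvT hvC hvQ huniq hT hC hQ).2
  exact (sub_eq_zero.1 h).symm

end Matrix

end Summit.HodgeConjecture.HodgeConjecture.Cruxes.H413.K2E1ScatteringFunctionalEquationOfUnique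

end
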